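import Literature.AlgebraicGeometry.Frobenioids.ArithmeticFrobenioidThm64ivSolitary
import Literature.AlgebraicGeometry.Frobenioids.ArithmeticFrobenioidFrobeniusCompact
import Literature.AlgebraicGeometry.Frobenioids.BaseSectionsOfObjectsCor57NonVacuity
import HarnessLib

/-!
# Frobenioids I, Theorem 6.4 (iv), second clause: the arithmetic-equivalence results OVER THE TYPED CONE NODE
# [FrdI] Cor. 4.11 (iv) (no datum binders; GAP-LEDGER G-L1t3-1 #2)

Mochizuki, *The geometry of Frobenioids I: the general theory*, Kyushu J. Math. **62** (2008) 293–400, §6,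
Thm. 6.4 (iv) p. 115 l. 23–29 [cite: MochizukiFrdI2008, Thm. 6.4 (iv) p.115]; Cor. 4.11 (iv) p. 92.

PROOF-ONLY file (cell abc-iut, layer L1; seat abc-iut-w4-d090 gen 5; 0 definitions). The files
`ArithmeticFrobenioidThm64ivArithEquivalence` / `…Solitary` / `…Sylow` / `…GaloisTarget` take the Cor. 4.11 (iv)
DATUM `(Ψ^Base, Ψ^Φ, η, hdiv)` of an equivalence `Ψ : C_{K₁/F₁} ⥲ C_{K₂/F₂}` of THE arithmetic Frobenioids as binders.
Here the datum is SUPPLIED from the typed cone node [FrdI] Cor. 4.11 (iv) for `Ψ` at THE parameters (binder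
`h411iv`, unpacked as in abc-iut-L1-d7's `exists_transport_of_cor411iv` — `datum_of_cor411iv` below, over
abc-iut-L1-d1's `cor411Setting_arith` and the rational-standardness `Thm64i_frobenioid_rsParams`; the node itself is
closed by abc-iut-L1-t14's general Cor. 4.11 files), and `Spec F₁` is instantiated as `⟨⊥⟩` (`IntermediateField.botEquiv`), so that every statement
below has ONLY `Ψ` and the typed node as hypotheses:

* `arith_arithmeticallyEquivalent_of_cor411iv` — `ArithmeticallyEquivalent F₁ F₂`; `arith_dedekindZeta_eq_of_cor411iv`,
  `arith_invariants_of_cor411iv` (Perlis' Theorem 1, kernel-proved);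
* `nonempty_baseRingEquiv_of_cor411iv_of_finrank_le_six` — `F₁ ≅ F₂` when `[F₁ : ℚ] ≤ 6` (the target-Galois
  and Sylow classes follow in the sequel `…SolitaryCor411B`, gated on the oleans of `…Sylow` / `…GaloisTarget`); and `Thm64iv_compat_of_cor411iv_of_finrank_le_six` — the printed clause «the
  corresponding `L₂` is isomorphic to `L₁` compatibly with an isomorphism `F₁ ⥲ F₂`» for THE `Ψ^Base` of the node,
  at every `X = Spec L₁` Galois over `ℚ`, whenever `[F₁ : ℚ] ≤ 6`.
Nothing here bears on, or takes a side on, [IUTchIII] Cor. 3.12.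
-/

noncomputable section

namespace Literature.AlgebraicGeometry.Frobenioids

open CategoryTheory Opposite NumberField
open Literature.NumberTheory.NumberFields

section Arith

variable {F₁ : Type} [Field F₁] [NumberField F₁] {K₁ : Type} [Field K₁] [Algebra F₁ K₁] [IsGalois F₁ K₁]
variable {F₂ : Type} [Field F₂] [NumberField F₂] {K₂ : Type} [Field K₂] [Algebra F₂ K₂] [IsGalois F₂ K₂]

/-- The Cor. 4.11 (iv) datum `(Ψ^Base, Ψ^Φ, η, hdiv)` of `Ψ` unpacked from the typed node at THE parameters (the
arithmetic Frobenioids satisfy `Cor411Setting` and are of rationally standard type — abc-iut-L1-d1's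
`cor411Setting_arith`, abc-iut-L6-t10's `Thm64i_frobenioid_rsParams`). [cite: MochizukiFrdI2008, Cor. 4.11 (iv) p.92] -/
private theorem datum_of_cor411iv (Ψ : arithFrobenioid F₁ K₁ ≌ arithFrobenioid F₂ K₂)
    (h411iv : PreFrobenioidData.Cor411iv (arithFrobenioidOps F₁ K₁) (arithFrobenioidOps F₂ K₂) Ψ
      (PreFrobenioid.rsParams (arithFrobenioid_isFrobenioid F₁ K₁) fun a 𝔭 => PrimarySupp a 𝔭)
      (PreFrobenioid.rsParams (arithFrobenioid_isFrobenioid F₂ K₂) fun a 𝔭 => PrimarySupp a 𝔭)) :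
    ∃ (ΨBase : FinSubextCat F₁ K₁ ⥤ FinSubextCat F₂ K₂)
      (E : PreFrobenioidData.DivisorMonoidIsoOverBase (arithFrobenioidOps F₁ K₁) (arithFrobenioidOps F₂ K₂) ΨBase)
      (η : Ψ.functor ⋙ (arithFrobenioidOps F₂ K₂).base ≅ (arithFrobenioidOps F₁ K₁).base ⋙ ΨBase),
      ΨBase.IsEquivalence ∧
      ∀ ⦃A B : arithFrobenioid F₁ K₁⦄ (φ : A ⟶ B),
        (arithFrobenioidOps F₂ K₂).div (Ψ.functor.map φ) =
          (arithFrobenioidOps F₂ K₂).pull (η.hom.app A)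
            (E.iso ((arithFrobenioidOps F₁ K₁).base.obj A) ((arithFrobenioidOps F₁ K₁).div φ)) := by
  obtain ⟨ΨBase, E, η, hEq, -, hdiv, -⟩ :=
    h411iv (cor411Setting_arith F₁ K₁ F₂ K₂ Ψ) (Thm64i_frobenioid_rsParams F₁ K₁).2.1
      (Thm64i_frobenioid_rsParams F₂ K₂).2.1
  exact ⟨ΨBase, E, η, hEq, hdiv⟩

/-- **From the typed [FrdI] Cor. 4.11 (iv) for `Ψ`: the base fields are ARITHMETICALLY EQUIVALENT** (equal splitting
types at every prime; Perlis' condition (b)). [cite: MochizukiFrdI2008, Thm. 6.4 (iv) p.116] -/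
theorem arith_arithmeticallyEquivalent_of_cor411iv (Ψ : arithFrobenioid F₁ K₁ ≌ arithFrobenioid F₂ K₂)
    (h411iv : PreFrobenioidData.Cor411iv (arithFrobenioidOps F₁ K₁) (arithFrobenioidOps F₂ K₂) Ψ
      (PreFrobenioid.rsParams (arithFrobenioid_isFrobenioid F₁ K₁) fun a 𝔭 => PrimarySupp a 𝔭)
      (PreFrobenioid.rsParams (arithFrobenioid_isFrobenioid F₂ K₂) fun a 𝔭 => PrimarySupp a 𝔭)) :
    ArithmeticallyEquivalent F₁ F₂ := by
  obtain ⟨ΨBase, E, η, hEq, hdiv⟩ := datum_of_cor411iv Ψ h411iv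
  exact arith_base_arithmeticallyEquivalent Ψ E η hdiv ⟨⊥⟩ (IntermediateField.botEquiv F₁ K₁)

/-- Hence `ζ_{F₁} = ζ_{F₂}` (Perlis' Theorem 1, kernel-proved). [cite: Perlis1977, Thm. 1 (p. 345)] -/
theorem arith_dedekindZeta_eq_of_cor411iv (Ψ : arithFrobenioid F₁ K₁ ≌ arithFrobenioid F₂ K₂)
    (h411iv : PreFrobenioidData.Cor411iv (arithFrobenioidOps F₁ K₁) (arithFrobenioidOps F₂ K₂) Ψ
      (PreFrobenioid.rsParams (arithFrobenioid_isFrobenioid F₁ K₁) fun a 𝔭 => PrimarySupp a 𝔭)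
      (PreFrobenioid.rsParams (arithFrobenioid_isFrobenioid F₂ K₂) fun a 𝔭 => PrimarySupp a 𝔭)) :
    NumberField.dedekindZeta F₁ = NumberField.dedekindZeta F₂ :=
  (Perlis1977_thm1_holds F₁ F₂).1.2 (arith_arithmeticallyEquivalent_of_cor411iv Ψ h411iv)

/-- Hence equal degree, discriminant, signature, and isomorphic unit groups (Perlis' Theorem 1, invariants).
[cite: Perlis1977, Thm. 1 (pp. 345–347)] -/
theorem arith_invariants_of_cor411iv (Ψ : arithFrobenioid F₁ K₁ ≌ arithFrobenioid F₂ K₂)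
    (h411iv : PreFrobenioidData.Cor411iv (arithFrobenioidOps F₁ K₁) (arithFrobenioidOps F₂ K₂) Ψ
      (PreFrobenioid.rsParams (arithFrobenioid_isFrobenioid F₁ K₁) fun a 𝔭 => PrimarySupp a 𝔭)
      (PreFrobenioid.rsParams (arithFrobenioid_isFrobenioid F₂ K₂) fun a 𝔭 => PrimarySupp a 𝔭)) :
    Module.finrank ℚ F₁ = Module.finrank ℚ F₂ ∧ NumberField.discr F₁ = NumberField.discr F₂ ∧
      NumberField.InfinitePlace.nrRealPlaces F₁ = NumberField.InfinitePlace.nrRealPlaces F₂ ∧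
      NumberField.InfinitePlace.nrComplexPlaces F₁ = NumberField.InfinitePlace.nrComplexPlaces F₂ ∧
      Nonempty ((𝓞 F₁)ˣ ≃* (𝓞 F₂)ˣ) :=
  (Perlis1977_thm1_holds F₁ F₂).2.2.2 (arith_arithmeticallyEquivalent_of_cor411iv Ψ h411iv)

/-- **`F₁ ≅ F₂` from the typed Cor. 4.11 (iv) when `[F₁ : ℚ] ≤ 6`** (Perlis' Theorem 3).
[cite: MochizukiFrdI2008, Thm. 6.4 (iv) p.115] -/
theorem nonempty_baseRingEquiv_of_cor411iv_of_finrank_le_six (hdeg : Module.finrank ℚ F₁ ≤ 6)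
    (Ψ : arithFrobenioid F₁ K₁ ≌ arithFrobenioid F₂ K₂)
    (h411iv : PreFrobenioidData.Cor411iv (arithFrobenioidOps F₁ K₁) (arithFrobenioidOps F₂ K₂) Ψ
      (PreFrobenioid.rsParams (arithFrobenioid_isFrobenioid F₁ K₁) fun a 𝔭 => PrimarySupp a 𝔭)
      (PreFrobenioid.rsParams (arithFrobenioid_isFrobenioid F₂ K₂) fun a 𝔭 => PrimarySupp a 𝔭)) :
    Nonempty (F₁ ≃+* F₂) := by
  obtain ⟨e⟩ := Perlis1977_thm3_holds F₁ F₂ hdeg (arith_arithmeticallyEquivalent_of_cor411iv Ψ h411iv)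
  exact ⟨e.toRingEquiv⟩

/-- **The printed clause from the typed Cor. 4.11 (iv) when `[F₁ : ℚ] ≤ 6`**: THE `Ψ^Base` of the node (an
equivalence lying under `Ψ`) carries every `X = Spec L₁` with `L₁` Galois over `ℚ` to `Spec L₂` with `L₂ ≅ L₁`
compatibly with an isomorphism `F₁ ⥲ F₂`. [cite: MochizukiFrdI2008, Thm. 6.4 (iv) p.115] -/
theorem Thm64iv_compat_of_cor411iv_of_finrank_le_six (hdeg : Module.finrank ℚ F₁ ≤ 6)
    (Ψ : arithFrobenioid F₁ K₁ ≌ arithFrobenioid F₂ K₂)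
    (h411iv : PreFrobenioidData.Cor411iv (arithFrobenioidOps F₁ K₁) (arithFrobenioidOps F₂ K₂) Ψ
      (PreFrobenioid.rsParams (arithFrobenioid_isFrobenioid F₁ K₁) fun a 𝔭 => PrimarySupp a 𝔭)
      (PreFrobenioid.rsParams (arithFrobenioid_isFrobenioid F₂ K₂) fun a 𝔭 => PrimarySupp a 𝔭)) :
    ∃ (ΨBase : FinSubextCat F₁ K₁ ⥤ FinSubextCat F₂ K₂) (_ : ΨBase.IsEquivalence)
      (_ : Ψ.functor ⋙ (arithFrobenioidOps F₂ K₂).base ≅ (arithFrobenioidOps F₁ K₁).base ⋙ ΨBase),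
      ∀ (X : FinSubextCat F₁ K₁), IsGalois ℚ X.L →
        ∃ (e : X.L ≃+* (ΨBase.obj X).L) (e₀ : F₁ ≃+* F₂),
          ∀ a : F₁, e (algebraMap F₁ X.L a) = algebraMap F₂ (ΨBase.obj X).L (e₀ a) := by
  obtain ⟨ΨBase, E, η, hEq, hdiv⟩ := datum_of_cor411iv Ψ h411iv
  exact ⟨ΨBase, hEq, η, fun X hX =>
    Thm64iv_arith_compat_of_finrank_le_six hdeg Ψ E η hdiv ⟨⊥⟩ (IntermediateField.botEquiv F₁ K₁) X hX⟩

end Arith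

end Literature.AlgebraicGeometry.Frobenioids

end
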